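import Summits.QuantumFields.YangMills.Theorems.AlphaInputsT3ACv3AbelianFineLift
import Summits.QuantumFields.YangMills.Theorems.AlphaInputsT3ACv3AbelianRegionalLiftCurl
import HarnessLib

/-!
# `AlphaInputsT3ACv3InnerLiftFineAbelian` — STRATEGY B for 2′: ★★★ (FL) FOR ABELIAN DATA, PROVED — at every `k ≤ K`, every history `h`, and every charged datum `W` that is
# abelian on `bondsIn k Ω_k(h)` (`W = gexpAt A` along a direction `Y ∈ 𝔰𝔲(2)∖0`, the curls of `A` within `ε` on the level-`k` plaquettes of `Ω_k(h)`, `4800·ε·‖Y‖ < α`),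
# there IS a finest configuration with EXACT `k`-fold `blockAvg ℰp`-averages `W` on `bondsIn k Ω_k(h)` and finest plaquettes under `Ω_k(h)` within `α·L^{−2k}` — lane
# `pub-balaban3d`, seat alpha-2 (g5)

WHY (OWNER DEPMAP v3.3, 2026-08-27T22:38Z: the displayed W-dependent kinematic row of 2′∕2′χ is (FL) `AlphaInputsT3AC.InnerFineLiftsT3`; «abelian case first»).  Seat g4 reduced the
abelian case to (LL) the linear regional lift (`fineLift_of_linearLift_abelian`, p581514); THIS SEAT proved (LL) (`AbelianEML.Tensor.exists_linearLift_region`,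
`…v3AbelianRegionalLiftCurl`: naive crossing-bond lift + tensor-product correctors hosted away from the region's boundary; exact on every bond, curls `≤ 4800·ε·L^{−2k}`
under the region).  THIS FILE composes the two: ★★★ `AlphaInputsT3AC.fineLift_abelian` — the (FL) clause at `(k, h, W)` for abelian `W`, with the witness `gexpAt a`.
WHAT REMAINS of (FL): non-abelian data ([Balaban1985Variational] (11)–(13) with free boundary — the inner lift of a genuinely non-commutative datum), the XL item of the line.
HONEST FRAMING.  (FL) is proved here ONLY for abelian data; nothing of [B10]∕[7]∕[4]'s estimates asserted beyond the tree's proved (0.4) calculus; count-neutral helper toward R3 2′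
(`stub_laneRecordsV3`, items 19935∕19936); registry untouched; nothing about d = 4, the continuum, or a mass gap.

References: T. Bałaban, Commun. Math. Phys. 102 (1985) 277–309 [Balaban1985Variational] ((2), (8) pp.278–279); CMP 109 (1987) 249–301 [Balaban1987RG1] ((0.4), (0.11)
p.253); CMP 98 (1985) 17–51 [Balaban1985Averaging] ((24) p.21).
-/

set_option autoImplicit false

noncomputable section

namespace Summit.QuantumFields.YangMills.Theorems

open MeasureTheory Set
open scoped Matrix.Norms.L2Operator
open Literature.MathematicalPhysics.QuantumFieldTheory.Balaban1983to89
open Literature.MathematicalPhysics.QuantumFieldTheory.Balaban1983to89.T3ContinuumYM3Torus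
open Literature.MathematicalPhysics.QuantumFieldTheory.Balaban1983to89.ExpMeanLog (deltaSU)
open Literature.MathematicalPhysics.QuantumFieldTheory.Balaban1983to89.B10Eq38TorusDomains (plaqsIn toFine)
open Literature.MathematicalPhysics.QuantumFieldTheory.Balaban1983to89.B10Eq42TorusConstraint (bondsIn)
open Literature.MathematicalPhysics.QuantumFieldTheory.Balaban1985CMP102.Setting
open Summit.QuantumFields.Balaban3D.Carriers
open Summit.QuantumFields.Balaban3D.Proofs.Primitives (AlphaConsts)
open Summit.QuantumFields.YangMills.Theorems.AbelianEML (gexpAt linAvgIter curlAt)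
open Summit.QuantumFields.YangMills.Theorems.AbelianEML.Tensor (exists_linearLift_region)

section T3

variable {F : T3Family} {𝔠 : AlphaConsts F.L (suGroupModel 2).N} {γ : ℝ} {hγ : 0 < γ} {hγ1 : γ ≤ (min 𝔠.gamma0 1) ^ 2} {K : ℕ}

/-- **`Ω_k(h)` IS A UNION OF LEVEL-`k` BLOCKS** in the form the lift needs: membership is decided by the block centre. [cite: Balaban1985UV3, (39) p.266] -/
theorem AlphaInputsT3AC.mem_Omega_iff_centre {k : ℕ} (hk : k ≤ K) (h : Hist (F.P K) k) (w : Site (F.P K) 0) :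
    w ∈ Omega 𝔠.lane.carrier.M₁ (rcolOf (T3Scales F γ hγ (hγ1.trans (sq_min_one_le _ 𝔠.gamma0_pos)) K) 𝔠.lane.carrier) k h k ↔
      toFine k (coarsen k w) ∈ Omega 𝔠.lane.carrier.M₁ (rcolOf (T3Scales F γ hγ (hγ1.trans (sq_min_one_le _ 𝔠.gamma0_pos)) K) 𝔠.lane.carrier) k h k :=
  mem_Omega_iff_of_coarsen_eq _ _ h le_rfl le_rfl (by rw [coarsen_toFine k (AlphaInputsT3AC.le_standing_of_le hk)])

/-- **★★★ (FL) FOR ABELIAN DATA** (`k ≤ K`, `h` any history of the run): let `Y ∈ 𝔰𝔲(2) ∖ 0` and `A` a one-form on the bonds of `T^{(k)}` whose curls are within `ε ≥ 0` at every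
level-`k` plaquette with its four corner blocks in `Ω_k(h)`; assume `4800·ε·‖Y‖ < α` and `(π/2)·((5L)²/4)·α ≤ min(δ_N, ln 2)`.  Then for every `W` agreeing with `gexpAt A` on
`bondsIn k Ω_k(h)` there is a finest `U` (namely `gexpAt a` for the linear regional lift `a` of `A`) with `(blockAvg ℰp)^k U = W` on `bondsIn k Ω_k(h)` (`U ∈ top42Set k h W`) and
every finest plaquette with four corners in `Ω_k(h)` within `α·L^{−2k}` — the (FL) clause `InnerFineLiftsT3` at `(k, h, W)` for abelian data.
[cite: Balaban1985Variational, (2)+(8) pp.278–279; Balaban1987RG1, (0.4)+(0.11) p.253] -/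
theorem AlphaInputsT3AC.fineLift_abelian {k : ℕ} (hk : k ≤ K) (h : Hist (F.P K) k)
    {Y : Matrix (Fin 2) (Fin 2) ℂ} (hY : Y ∈ (suGroupModel 2).lie) (hY0 : Y ≠ 0)
    (A : PBond (F.P K) k → ℝ) {ε α : ℝ} (hε : 0 ≤ ε)
    (hA : ∀ (y : Site (F.P K) k) (μ ν : Fin 3), μ ≠ ν →
      toFine k y ∈ Omega 𝔠.lane.carrier.M₁ (rcolOf (T3Scales F γ hγ (hγ1.trans (sq_min_one_le _ 𝔠.gamma0_pos)) K) 𝔠.lane.carrier) k h k →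
      toFine k (y.shift μ) ∈ Omega 𝔠.lane.carrier.M₁ (rcolOf (T3Scales F γ hγ (hγ1.trans (sq_min_one_le _ 𝔠.gamma0_pos)) K) 𝔠.lane.carrier) k h k →
      toFine k (y.shift ν) ∈ Omega 𝔠.lane.carrier.M₁ (rcolOf (T3Scales F γ hγ (hγ1.trans (sq_min_one_le _ 𝔠.gamma0_pos)) K) 𝔠.lane.carrier) k h k →
      toFine k ((y.shift μ).shift ν) ∈ Omega 𝔠.lane.carrier.M₁ (rcolOf (T3Scales F γ hγ (hγ1.trans (sq_min_one_le _ 𝔠.gamma0_pos)) K) 𝔠.lane.carrier) k h k →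
      |curlAt A y μ ν| ≤ ε)
    (hεα : 4800 * ε * ‖Y‖ < α)
    (hα : Real.pi / 2 * ((((3 + 2) * F.L : ℕ) : ℝ) ^ 2 / 4) * α ≤ min (deltaSU (Fin 2)) (Real.log 2))
    (W : GaugeField (F.P K) k (Matrix.specialUnitaryGroup (Fin 2) ℂ))
    (hW : ∀ b : PBond (F.P K) k, b ∈ bondsIn k (Omega 𝔠.lane.carrier.M₁
        (rcolOf (T3Scales F γ hγ (hγ1.trans (sq_min_one_le _ 𝔠.gamma0_pos)) K) 𝔠.lane.carrier) k h k) → W b = gexpAt (suGroupModel 2) hY A b) :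
    ∃ U : GaugeField (F.P K) 0 (Matrix.specialUnitaryGroup (Fin 2) ℂ),
      U ∈ AlphaInputsT3AC.top42Set F 𝔠 γ hγ hγ1 K k h W ∧
      ∀ q : Plaq (F.P K) 0, q ∈ plaqsIn 0 (Omega 𝔠.lane.carrier.M₁
          (rcolOf (T3Scales F γ hγ (hγ1.trans (sq_min_one_le _ 𝔠.gamma0_pos)) K) 𝔠.lane.carrier) k h k) →
        GaugeGroup.dist1 (GaugeField.plaqHol U q) < α * (((F.L : ℝ) ^ k)⁻¹) ^ 2 := by
  set Ω : Set (Site (F.P K) 0) := Omega 𝔠.lane.carrier.M₁ (rcolOf (T3Scales F γ hγ (hγ1.trans (sq_min_one_le _ 𝔠.gamma0_pos)) K) 𝔠.lane.carrier) k h k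
    with hΩdef
  have hΩ : ∀ w : Site (F.P K) 0, w ∈ Ω ↔ toFine k (coarsen k w) ∈ Ω := fun w => AlphaInputsT3AC.mem_Omega_iff_centre (hγ := hγ) (hγ1 := hγ1) hk h w
  -- the linear regional lift of `A`
  obtain ⟨a, hlin, hcurl⟩ := exists_linearLift_region hk Ω hΩ A hε hA
  set B : ℝ := 4800 * ε * (((F.L : ℝ) ^ k)⁻¹) ^ 2 with hB
  have hL : (0 : ℝ) < F.L := by exact_mod_cast (zero_lt_one.trans F.hL.2)
  have hB0 : 0 ≤ B := by rw [hB]; positivity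
  have hBα : B * ‖Y‖ < α * (((F.L : ℝ) ^ k)⁻¹) ^ 2 := by
    have hpos : 0 < (((F.L : ℝ) ^ k)⁻¹) ^ 2 := by positivity
    rw [hB, show 4800 * ε * (((F.L : ℝ) ^ k)⁻¹) ^ 2 * ‖Y‖ = (4800 * ε * ‖Y‖) * (((F.L : ℝ) ^ k)⁻¹) ^ 2 by ring]
    exact mul_lt_mul_of_pos_right hεα hpos
  have hthr := AlphaInputsT3AC.thresholds_of_fine_budget (F := F) (Y := Y) hB0 hBα hα
  exact ⟨gexpAt (suGroupModel 2) hY a, AlphaInputsT3AC.fineLift_of_linearLift_abelian (hγ := hγ) (hγ1 := hγ1) hk h hY hY0 A a (fun b _ => hlin b) hB0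
    (fun x μ ν hμν h1 h2 h3 h4 => hcurl x μ ν hμν h1 h2 h3 h4) hBα hthr W hW⟩

end T3

end Summit.QuantumFields.YangMills.Theorems

end
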